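import Summits.AtomisticToContinuum.FouriersLaw.Theorems.BondHeatUncertaintyExtensiveSnapshotIrreversibilityEnergyWindowDepartureGlue
import Summits.AtomisticToContinuum.FouriersLaw.Theorems.BondHeatUncertaintyExtensiveSnapshotIrreversibilityEnergyWindowSkeletonSurjectivityProof

/-!
# Energy window, part W-7c — the junctions with (I-s2)ₛ discharged: S3 ⟸ (Dˢ) ∧ (SWM)

Lineage `stmt-AtomisticToContinuum-9121` (`ExtensiveSnapshotIrreversibility`), K_fix half, leaf S3;
cell decomp-a2c, lens «grading / quantitative ladder», generation 81, part W «Glues», file 7c.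
Imports W-6 (`…EnergyWindowDepartureGlue`: the V-glue, the U-glue via W-3, and the junctions §7, all
with the hypothesis `(hI : SkeletonEventualSurjectivity)`) and W-7b
(`…EnergyWindowSkeletonSurjectivityProof`: `skeletonEventualSurjectivity : SkeletonEventualSurjectivity`).
CONTENT: the hypothesis `hI` is discharged everywhere —
* `perturbedKernelMomentumIBPCompact_of_weights (hW : SkeletonWeightMoments) :
  PerturbedKernelMomentumIBPCompact` (U side, (G1*ᶜᶜ));
* `equalTemperatureBathLipschitz_of_weights (hW : SkeletonWeightMoments) : EqualTemperatureBathLipschitz`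
  (V side, (G1ℓ));
* `kernelTemperatureLipschitz_of_weights (hD : KernelTemperatureDuhamelSmooth) (hW : SkeletonWeightMoments) :
  KernelTemperatureLipschitz` — THE RECORD OF GENERATION 81: S3 ⟸ (Dˢ) ∧ (SWM);
* `snapshotKLUpperExpansion_of_atoms₆W` — K_fix ⟸ A0 ∧ A2 ∧ (Dˢ) ∧ (SWM) ∧ A3p ∧ A4.
(SWM) `SkeletonWeightMoments` (part R, byte-frozen) stays a HYPOTHESIS: no κ → 0 / level-asymptotic /
anharmonic claim about the skeleton weights is made here (critic row 1093 (g)); (Dˢ)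
`KernelTemperatureDuhamelSmooth` is the hands' item.  No instance / notation / option; no proof holes.
[folklore]
-/

noncomputable section

namespace Summit.AtomisticToContinuum.FouriersLaw.Theorems.ExtensiveSnapshotIrreversibility.EnergyWindow

/-- **U side with (I-s2)ₛ discharged**: (SWM) ⟹ (G1*ᶜᶜ) `PerturbedKernelMomentumIBPCompact` (W-3
`perturbedKernelMomentumIBPCompact_of_skeleton` + tree (JMˣ)₂ `skeletonSecondVariationMoments` + W-7b
`skeletonEventualSurjectivity`). [folklore] -/
theorem perturbedKernelMomentumIBPCompact_of_weights (hW : SkeletonWeightMoments) :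
    PerturbedKernelMomentumIBPCompact :=
  perturbedKernelMomentumIBPCompact_of_skeleton₂ hW skeletonEventualSurjectivity

/-- **V side with (I-s2)ₛ discharged**: (SWM) ⟹ (G1ℓ) `EqualTemperatureBathLipschitz` (W-6
`equalTemperatureBathLipschitz_of_skeleton` + W-7b `skeletonEventualSurjectivity`). [folklore] -/
theorem equalTemperatureBathLipschitz_of_weights (hW : SkeletonWeightMoments) :
    EqualTemperatureBathLipschitz :=
  equalTemperatureBathLipschitz_of_skeleton hW skeletonEventualSurjectivity

/-- **THE RECORD OF GENERATION 81: S3 ⟸ (Dˢ) ∧ (SWM).**  `KernelTemperatureLipschitz` (leaf S3 of the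
K_fix half) follows from the hands' smooth Duhamel identity (Dˢ) `KernelTemperatureDuhamelSmooth` and the
skeleton weight moments (SWM) `SkeletonWeightMoments` (tree junction
`kernelTemperatureLipschitz_of_testClasses` + the two glues + W-7b). [folklore] -/
theorem kernelTemperatureLipschitz_of_weights (hD : KernelTemperatureDuhamelSmooth)
    (hW : SkeletonWeightMoments) : KernelTemperatureLipschitz :=
  kernelTemperatureLipschitz_of_skeleton hD hW skeletonEventualSurjectivity

/-- **K_fix ⟸ A0 ∧ A2 ∧ (Dˢ) ∧ (SWM) ∧ A3p ∧ A4** (W-6 `snapshotKLUpperExpansion_of_atoms₇W` with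
(I-s2)ₛ discharged by W-7b). [folklore] -/
theorem snapshotKLUpperExpansion_of_atoms₆W (h0 : NessGibbsReweighting)
    (h2 : NessOddLogRatioBound) (hD : KernelTemperatureDuhamelSmooth)
    (hW : SkeletonWeightMoments) (h3p : NessFloorMeanValue) (h4 : NessLinearResponseL2) :
    SnapshotKLUpperExpansion :=
  snapshotKLUpperExpansion_of_atoms₇W h0 h2 hD hW skeletonEventualSurjectivity h3p h4

end Summit.AtomisticToContinuum.FouriersLaw.Theorems.ExtensiveSnapshotIrreversibility.EnergyWindow

end
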